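import Summits.Ventures.YMGap.Thresholds.QuarterModulusTwoThirds
import Summits.Ventures.YMGap.Thresholds.QuarterModulusOneHalf
import Summits.Ventures.YMGap.Thresholds.QuarterModulusOneThird
import Summits.Ventures.YMGap.SlabAreaLawVariance
import Literature.MathematicalPhysics.QuantumFieldTheory.DurhuusFrohlichSlabCriterionProofs
import HarnessLib

/-!
# Venture YMGap, track (a) A4 — the SU(2) / SU(3) strong-coupling AREA-LAW rows with the Durhuus–Fröhlich door DISCHARGED

HONEST FRAMING: venture file of the cell `pub-ymgap` (QuantumFields programme).  Until now every A4 row of the cell carried the named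
printed fact `durhuusFrohlich_areaLaw_of_slabClustering d N` (Durhuus–Fröhlich 1980 Thms 1.2–1.3 in the form of Cao–Nissim–Sheffield
2025 Thm 2.3: boundary-uniform slab clustering ⇒ Wilson area law) as a HYPOTHESIS.  That fact is now a tree THEOREM
(`durhuusFrohlich_areaLaw_of_slabClustering_holds`, lit-1, `DurhuusFrohlichSlabCriterionProofs`), so this file restates the cell's area-law
rows WITHOUT the door hypothesis (lead R112: one owner, one file):
* SU(2), `d = 4` (tree coupling `β_W/2`; printed threshold `β_W = 1/6`): `0 ≤ β_W < 2/3` — the A4 NUMBER OF RECORD (quarter modulus up to tilt `4`,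
  `QuarterModulusTwoThirds`), and the rungs `≤ 1/2` (tilt `3`), `≤ 1/3` (tilt `2`), `< 2/7` (FRONT-SC ball `κ ≤ 12/7`) — all now HYPOTHESIS-FREE;
* SU(3), `d = 4` (tree coupling `β_W/3`; printed `3/8`): `0 ≤ β_W ≤ 11/20` conditional ONLY on the one-link leaf Props — either the Poincaré pair
  (`OneLinkPoincareSUN 3 (11/30) (53/100)` + `OneLinkVarianceBound 3 (11/30) (49/20)`, `SlabAreaLawSU3`) or the variance schema alone
  (`OneLinkVarianceBound 3 (11/30) (49/20)`, `SlabAreaLawVariance`, Bakry–Émery Poincaré proved).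
Finite-lattice strong-coupling statements (`HasAreaLaw` = uniform-in-`L` area-law bound on rectangular Wilson-loop expectations on the tori
`(ℤ/L)^4`); nothing about the continuum, a mass gap, or any `β_W` beyond the stated windows.
-/

noncomputable section

open Literature.MathematicalPhysics.QuantumLattice (fundamentalRep)
open Literature.MathematicalPhysics.QuantumFieldTheory
open Summit.QuantumFields.BalabanUV.InfraRed.StrongCouplingVarianceDoorSUN (OneLinkVarianceBound)
open Summit.QuantumFields.BalabanUV.InfraRed.StrongCouplingPoincareDoorSUN

namespace Summit.Ventures.YMGap.Slab

/-! ## SU(2), `d = 4` — hypothesis-free -/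

/-- **SU(2), `d = 4`: AREA LAW for every `0 ≤ β_W < 2/3`, UNCONDITIONAL** — the cell's A4 number of record (printed `1/6`; tree coupling
`β_W/2`).  Composition of `QuarterModulusTwoThirds.su2_hasAreaLaw_lt_twoThirds` (slab Dobrushin door + quarter modulus up to tilt `4`) with the
discharged Durhuus–Fröhlich criterion. [cite: CaoNissimSheffield2025dynamical, Theorem 2.3] -/
theorem su2_hasAreaLaw_lt_twoThirds_unconditional {βW : ℝ} (hβ : 0 ≤ βW) (hlt : βW < 2 / 3) :
    HasAreaLaw 4 (fundamentalRep (Fin 2)) (βW / 2) :=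
  QuarterModulusTwoThirds.su2_hasAreaLaw_lt_twoThirds durhuusFrohlich_areaLaw_of_slabClustering_holds hβ hlt

/-- SU(2), `d = 4`, the point `β_W = 13/20` (inside the `2/3` window): area law, unconditional. [folklore] -/
theorem su2_hasAreaLaw_thirteenTwentieths_unconditional : HasAreaLaw 4 (fundamentalRep (Fin 2)) ((13 / 20 : ℝ) / 2) :=
  su2_hasAreaLaw_lt_twoThirds_unconditional (by norm_num) (by norm_num)

/-- **SU(2), `d = 4`: area law for every `0 ≤ β_W ≤ 1/2`, unconditional** (the tilt-`3` rung, `QuarterModulusOneHalf`).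
[cite: CaoNissimSheffield2025dynamical, Theorem 2.3] -/
theorem su2_hasAreaLaw_le_oneHalf_unconditional {βW : ℝ} (hβ : 0 ≤ βW) (hle : βW ≤ 1 / 2) :
    HasAreaLaw 4 (fundamentalRep (Fin 2)) (βW / 2) :=
  QuarterModulusOneHalf.su2_hasAreaLaw_le_oneHalf durhuusFrohlich_areaLaw_of_slabClustering_holds hβ hle

/-- SU(2), `d = 4`, the endpoint `β_W = 1/2` (`g² = 8`, tree coupling `1/4`): area law, unconditional. [folklore] -/
theorem su2_hasAreaLaw_oneHalf_unconditional : HasAreaLaw 4 (fundamentalRep (Fin 2)) ((1 / 2 : ℝ) / 2) :=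
  su2_hasAreaLaw_le_oneHalf_unconditional (by norm_num) le_rfl

/-- SU(2), `d = 4`, `0 ≤ β_W ≤ 1/3` (the tilt-`2` rung, `QuarterModulusOneThird`): area law, unconditional. [folklore] -/
theorem su2_hasAreaLaw_le_oneThird_unconditional {βW : ℝ} (hβ : 0 ≤ βW) (hle : βW ≤ 1 / 3) :
    HasAreaLaw 4 (fundamentalRep (Fin 2)) (βW / 2) :=
  QuarterModulusOneThird.su2_hasAreaLaw_le_oneThird durhuusFrohlich_areaLaw_of_slabClustering_holds hβ hle

/-- SU(2), `d = 4`, `0 ≤ β_W < 2/7` (the FRONT-SC quarter-modulus ball `κ ≤ 12/7`, `SlabAreaLaw`): area law, unconditional. [folklore] -/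
theorem su2_hasAreaLaw_lt_twoSevenths_unconditional {βW : ℝ} (hβ : 0 ≤ βW) (hlt : βW < 2 / 7) :
    HasAreaLaw 4 (fundamentalRep (Fin 2)) (βW / 2) :=
  su2_hasAreaLaw_lt_twoSevenths durhuusFrohlich_areaLaw_of_slabClustering_holds hβ hlt

/-! ## SU(3), `d = 4` — only the one-link leaf Props remain -/

/-- **SU(3), `d = 4`: AREA LAW for every `0 ≤ β_W ≤ 11/20`** (tree coupling `β_W/3`; printed `3/8`), conditional ONLY on the two one-link leaf
Props of the SU(N) Poincaré door (`SlabAreaLawSU3.su3_hasAreaLaw_le_elevenTwentieths` with the Durhuus–Fröhlich criterion discharged).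
[cite: CaoNissimSheffield2025dynamical, Theorem 2.3] -/
theorem su3_hasAreaLaw_le_elevenTwentieths_of_leaves (hP : OneLinkPoincareSUN 3 (11 / 30) (53 / 100))
    (hv : OneLinkVarianceBound 3 (11 / 30) (49 / 20)) {βW : ℝ} (hβ : 0 ≤ βW) (hle : βW ≤ 11 / 20) :
    HasAreaLaw 4 (fundamentalRep (Fin 3)) (βW / 3) :=
  su3_hasAreaLaw_le_elevenTwentieths durhuusFrohlich_areaLaw_of_slabClustering_holds hP hv hβ hle

/-- **SU(3), `d = 4`: AREA LAW for every `0 ≤ β_W ≤ 11/20`, conditional ONLY on the one-link variance schema**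
`OneLinkVarianceBound 3 (11/30) (49/20)` (`SlabAreaLawVariance.su3_hasAreaLaw_le_elevenTwentieths_of_varianceBound`: the Poincaré input is the
proved Bakry–Émery constant; the Durhuus–Fröhlich criterion is discharged here). [cite: CaoNissimSheffield2025dynamical, Theorem 2.3] -/
theorem su3_hasAreaLaw_le_elevenTwentieths_of_varianceBound' (hv : OneLinkVarianceBound 3 (11 / 30) (49 / 20)) {βW : ℝ} (hβ : 0 ≤ βW)
    (hle : βW ≤ 11 / 20) : HasAreaLaw 4 (fundamentalRep (Fin 3)) (βW / 3) :=
  SlabAreaLawVariance.su3_hasAreaLaw_le_elevenTwentieths_of_varianceBound durhuusFrohlich_areaLaw_of_slabClustering_holds hv hβ hle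

end Summit.Ventures.YMGap.Slab
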